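import Mathlib
import HarnessLib
import Summits.Ventures.LatticeQCDFlow.Exactness.SphereLuscherMomentIdentity
import Summits.Ventures.LatticeQCDFlow.Exactness.SphereKickJacobianTransport

/-!
# Parity of Lüscher's constants on the lattice of site spheres: if the odd central moments of the action vanish then `ċ_{2j} = 0` for all `j ≥ 1`; for the CP(N−1)/O(N) action on a BIPARTITE coupling graph the sublattice flip makes `S − S₀` odd, so `Ċ_t + S₀` is an odd function of `t`

HONEST FRAMING: exact (Metropolis-corrected) sampling algorithms for lattice gauge theory;
figures of merit are autocorrelation/cost numbers at stated couplings and volumes; no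
continuum-physics claim.

Venture `LatticeQCDFlow` (cell pub-lqcd), topic `Exactness`; FANOUT row 7 (`s0-cpn-null`).  NEW WORK
of the cell over the tree's `Exactness/SphereLuscherMomentIdentity.lean` (this leg: the moment
identity `Σ_{i≤k} ċ_i·m_{k−i}/(k−i)! = m_{k+1}/k!` for every `C²` Lüscher series of a `C¹` action),
`Exactness/SphereLuscherGeneratorNormEquivalence.lean` (`∂̃` ignores additive constants),
`Exactness/SphereKickJacobianTransport.lean` (GEN-5: `isoSphere`, `map_isoSphere_toSphere` — the
sphere measure is covariant under linear isometries), `Exactness/SphereLOFlowAction.lean` (the E–S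
action) and Mathlib (`measurePreserving_pi`, `LinearIsometryEquiv.measurePreserving`); nothing is
cited as a fact.  Printed counterpart, NAMED ONLY: M. Lüscher, Commun. Math. Phys. 293 (2010) 899,
§4.2 (4.9)–(4.10) (`Ċ_t = (d/dt)ln⟨e^{−tS}⟩`); Engel–Schaefer, Comput. Phys. Commun. 182 (2011) 2107
(the CP(N−1) model on the square lattice with nearest-neighbour couplings — a bipartite coupling
graph when the side lengths are even).  THIS FILE: (i) a Lüscher series of `S` is a Lüscher series
of every shifted action `S − a` with `ċ₀ ↦ ċ₀ + a` (the recursion only sees `∂̃S`), so the moment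
identity holds with the moments of `a − S` for any `a`; (ii) PARITY: if all odd moments
`∫(a − S)^{2j+1}dπ̄` vanish for some `a`, then `ċ₀ = −a` and `ċ_{2j} = 0` for every `j ≥ 1` — the even
part of `Ċ_t` is the constant `−a`; (iii) for the Engel–Schaefer action on a BIPARTITE coupling graph
(`U_nm ≠ 0 ⇒` exactly one of `n, m` in `A`) the sublattice flip `x_n ↦ −x_n (n ∈ A)` preserves `π̄` and
reverses the sign of `S − S₀`, so every odd central moment of `S` vanishes and (ii) applies with
`a = S₀`: `ċ₂ = ċ₄ = … = 0` for every `C²` Lüscher series of the CP(N−1)/O(N) action on such a graph.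

## Content

* §1 `luscher_series_shift_zero/_succ` (shifting the action), **`luscher_constant_shifted_moment_identity`**
  (`Σ_{i≤k} ċ′_i·μ_{k−i}/(k−i)! = μ_{k+1}/k!`, `μ_j = ∫(a − S)^j dπ̄`, `ċ′ = ċ` except `ċ′₀ = ċ₀ + a`).
* §2 **`luscher_constant_even_eq_zero_of_odd_moments`** — vanishing odd moments of `a − S` force
  `ċ′_{2j} = 0` for all `j` (strong induction on `j` in the identity at `k = 2j`: even indices below `2j`
  vanish by induction, odd ones meet an odd moment); **`luscher_constant_two_mul_eq_zero`** (`ċ_{2j} = 0`,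
  `j ≥ 1`) and `luscher_constant_zero_eq_neg` (`ċ₀ = −a`).
* §3 THE SUBLATTICE FLIP: `measurePreserving_neg_uniformSphere` (the antipodal map preserves `σ̄`),
  `measurePreserving_sublatticeFlip` (`⊗`), **`esAction_sublatticeFlip`** (`S∘flip − S₀ = −(S − S₀)` on a
  bipartite coupling graph), **`integral_odd_pow_esAction_sub_eq_zero`** (`∫(S₀ − S)^{2j+1}dπ̄ = 0`) and
  **`luscher_constant_even_eq_zero_esAction_bipartite`** — for the E–S action on a bipartite coupling
  graph every `C²` Lüscher series has `ċ_{2j} = 0`, `j ≥ 1`.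

NOT CLAIMED: the instantiation for the periodic square lattice (needs even side lengths to be
bipartite — not constructed here); anything for non-bipartite graphs (triangles give `ċ₂ ≠ 0` in
general); odd constants; convergence; the rung's numbers.
-/

noncomputable section

namespace Summit.Ventures.LatticeQCDFlow.Exactness

open Function Set Metric MeasureTheory NormedSpace InnerProductSpace
open scoped RealInnerProductSpace Nat

variable {Λ : Type*} {E : Type*} [NormedAddCommGroup E] [InnerProductSpace ℝ E]
  [FiniteDimensional ℝ E] [MeasurableSpace E] [BorelSpace E] [Fintype Λ] [DecidableEq Λ] [Nontrivial E]

/-! ## §1 Shifting the action by a constant -/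

section Shift

variable {S : (Λ → E) → ℝ} {St : ℕ → (Λ → E) → ℝ} {c : ℕ → ℝ}

omit [MeasurableSpace E] [BorelSpace E] [Nontrivial E] in
/-- Order `0` of a Lüscher series of `S`, read as order `0` of a series of `S − a` with constant `ċ₀ + a`. -/
theorem luscher_series_shift_zero (a : ℝ)
    (h0 : ∀ ξ : Λ → sphere (0 : E) 1,
      -∑ n, siteLaplacian n (St 0) (fun m => (ξ m : E)) = S (fun m => (ξ m : E)) + c 0)
    (ξ : Λ → sphere (0 : E) 1) :
    -∑ n, siteLaplacian n (St 0) (fun m => (ξ m : E)) =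
      (fun x => S x - a) (fun m => (ξ m : E)) + update c 0 (c 0 + a) 0 := by
  rw [h0 ξ, update_self]
  ring

omit [MeasurableSpace E] [BorelSpace E] [Nontrivial E] in
/-- Higher orders of a Lüscher series of `S` are higher orders of a series of `S − a` (`∂̃(S − a) = ∂̃S`). -/
theorem luscher_series_shift_succ (a : ℝ)
    (hs : ∀ k, ∀ ξ : Λ → sphere (0 : E) 1,
      -∑ n, siteLaplacian n (St (k + 1)) (fun m => (ξ m : E)) =
        -(∑ n, ⟪siteGrad n S (fun m => (ξ m : E)), siteGrad n (St k) (fun m => (ξ m : E))⟫) +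
          c (k + 1))
    (k : ℕ) (ξ : Λ → sphere (0 : E) 1) :
    -∑ n, siteLaplacian n (St (k + 1)) (fun m => (ξ m : E)) =
      -(∑ n, ⟪siteGrad n (fun x => S x - a) (fun m => (ξ m : E)),
          siteGrad n (St k) (fun m => (ξ m : E))⟫) + update c 0 (c 0 + a) (k + 1) := by
  simp_rw [siteGrad_sub_const S a ξ, update_of_ne (Nat.succ_ne_zero k)]
  exact hs k ξ

/-- **The moment identity for the shifted action**: for every real `a`, every `C¹` action `S` and
every `C²` Lüscher series `(S̃⁽ᵏ⁾, ċ_k)` of `S`, with `μ_j = ∫(a − S)^j dπ̄` and `ċ′ = ċ` except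
`ċ′₀ = ċ₀ + a`: `Σ_{i≤k} ċ′_i·μ_{k−i}/(k−i)! = μ_{k+1}/k!`. -/
theorem luscher_constant_shifted_moment_identity (hS : ContDiff ℝ 1 S)
    (hSt : ∀ k, ContDiff ℝ 2 (St k))
    (h0 : ∀ ξ : Λ → sphere (0 : E) 1,
      -∑ n, siteLaplacian n (St 0) (fun m => (ξ m : E)) = S (fun m => (ξ m : E)) + c 0)
    (hs : ∀ k, ∀ ξ : Λ → sphere (0 : E) 1,
      -∑ n, siteLaplacian n (St (k + 1)) (fun m => (ξ m : E)) =
        -(∑ n, ⟪siteGrad n S (fun m => (ξ m : E)), siteGrad n (St k) (fun m => (ξ m : E))⟫) +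
          c (k + 1)) (a : ℝ) (k : ℕ) :
    ∑ i ∈ Finset.range (k + 1), update c 0 (c 0 + a) i *
        (∫ ω, (a - S (fun m => ((ω : Λ → sphere (0 : E) 1) m : E))) ^ (k - i)
          ∂Measure.pi (fun _ : Λ => uniformSphere (volume : Measure E))) / ((k - i)! : ℝ) =
      (∫ ω, (a - S (fun m => ((ω : Λ → sphere (0 : E) 1) m : E))) ^ (k + 1)
          ∂Measure.pi (fun _ : Λ => uniformSphere (volume : Measure E))) / (k ! : ℝ) := by
  have hSa : ContDiff ℝ 1 (fun x : Λ → E => S x - a) := hS.sub contDiff_const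
  have h := luscher_constant_moment_identity hSa hSt (luscher_series_shift_zero a h0)
    (luscher_series_shift_succ a hs) k
  have hneg : ∀ ω : Λ → sphere (0 : E) 1,
      -(fun x : Λ → E => S x - a) (fun m => (ω m : E)) = a - S (fun m => (ω m : E)) := fun ω => by
    simp only; ring
  simp_rw [hneg] at h
  exact h

end Shift

/-! ## §2 Parity: vanishing odd moments force vanishing even constants -/

section Parity

variable {S : (Λ → E) → ℝ} {St : ℕ → (Λ → E) → ℝ} {c : ℕ → ℝ}

/-- **VANISHING ODD MOMENTS OF `a − S` FORCE `ċ′_{2j} = 0` FOR ALL `j`** (`ċ′₀ = ċ₀ + a`, `ċ′_i = ċ_i`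
else): strong induction on `j` in the shifted moment identity at `k = 2j` — the right side is an odd
moment, the terms of even index below `2j` vanish by induction, those of odd index carry an odd
moment, and the top term is `ċ′_{2j}·μ₀ = ċ′_{2j}`. -/
theorem luscher_constant_even_eq_zero_of_odd_moments (hS : ContDiff ℝ 1 S)
    (hSt : ∀ k, ContDiff ℝ 2 (St k))
    (h0 : ∀ ξ : Λ → sphere (0 : E) 1,
      -∑ n, siteLaplacian n (St 0) (fun m => (ξ m : E)) = S (fun m => (ξ m : E)) + c 0)
    (hs : ∀ k, ∀ ξ : Λ → sphere (0 : E) 1,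
      -∑ n, siteLaplacian n (St (k + 1)) (fun m => (ξ m : E)) =
        -(∑ n, ⟪siteGrad n S (fun m => (ξ m : E)), siteGrad n (St k) (fun m => (ξ m : E))⟫) +
          c (k + 1)) {a : ℝ}
    (hodd : ∀ j : ℕ, ∫ ω, (a - S (fun m => ((ω : Λ → sphere (0 : E) 1) m : E))) ^ (2 * j + 1)
      ∂Measure.pi (fun _ : Λ => uniformSphere (volume : Measure E)) = 0) (j : ℕ) :
    update c 0 (c 0 + a) (2 * j) = 0 := by
  induction j using Nat.strong_induction_on with
  | _ j ih =>
    have h := luscher_constant_shifted_moment_identity hS hSt h0 hs a (2 * j)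
    rw [hodd j, zero_div, Finset.sum_range_succ] at h
    simp only [Nat.sub_self, pow_zero, Nat.factorial_zero, Nat.cast_one, div_one, integral_const,
      smul_eq_mul, mul_one, Measure.real, measure_univ, ENNReal.toReal_one] at h
    have hrest : ∑ i ∈ Finset.range (2 * j), update c 0 (c 0 + a) i *
        (∫ ω, (a - S (fun m => ((ω : Λ → sphere (0 : E) 1) m : E))) ^ (2 * j - i)
          ∂Measure.pi (fun _ : Λ => uniformSphere (volume : Measure E))) / ((2 * j - i)! : ℝ) = 0 := by
      refine Finset.sum_eq_zero fun i hi => ?_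
      have hi' : i < 2 * j := Finset.mem_range.1 hi
      rcases Nat.even_or_odd i with ⟨i', rfl⟩ | ⟨i', rfl⟩
      · -- even index below `2j`: the constant vanishes by induction
        have hi'' : i' < j := by omega
        rw [show i' + i' = 2 * i' by ring, ih i' hi'', zero_mul, zero_div]
      · -- odd index: the complementary moment is odd
        have e : 2 * j - (2 * i' + 1) = 2 * (j - i' - 1) + 1 := by omega
        rw [e, hodd (j - i' - 1), mul_zero, zero_div]
    rw [hrest, zero_add] at h
    exact h

/-- **`ċ_{2j} = 0` for `j ≥ 1`** whenever the odd moments of `a − S` under `π̄` vanish for some `a`. -/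
theorem luscher_constant_two_mul_eq_zero (hS : ContDiff ℝ 1 S) (hSt : ∀ k, ContDiff ℝ 2 (St k))
    (h0 : ∀ ξ : Λ → sphere (0 : E) 1,
      -∑ n, siteLaplacian n (St 0) (fun m => (ξ m : E)) = S (fun m => (ξ m : E)) + c 0)
    (hs : ∀ k, ∀ ξ : Λ → sphere (0 : E) 1,
      -∑ n, siteLaplacian n (St (k + 1)) (fun m => (ξ m : E)) =
        -(∑ n, ⟪siteGrad n S (fun m => (ξ m : E)), siteGrad n (St k) (fun m => (ξ m : E))⟫) +
          c (k + 1)) {a : ℝ}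
    (hodd : ∀ j : ℕ, ∫ ω, (a - S (fun m => ((ω : Λ → sphere (0 : E) 1) m : E))) ^ (2 * j + 1)
      ∂Measure.pi (fun _ : Λ => uniformSphere (volume : Measure E)) = 0) {j : ℕ} (hj : 1 ≤ j) :
    c (2 * j) = 0 := by
  have h := luscher_constant_even_eq_zero_of_odd_moments hS hSt h0 hs hodd j
  rwa [update_of_ne (by omega : 2 * j ≠ 0)] at h

/-- … and `ċ₀ = −a` (the case `j = 0`). -/
theorem luscher_constant_zero_eq_neg (hS : ContDiff ℝ 1 S) (hSt : ∀ k, ContDiff ℝ 2 (St k))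
    (h0 : ∀ ξ : Λ → sphere (0 : E) 1,
      -∑ n, siteLaplacian n (St 0) (fun m => (ξ m : E)) = S (fun m => (ξ m : E)) + c 0)
    (hs : ∀ k, ∀ ξ : Λ → sphere (0 : E) 1,
      -∑ n, siteLaplacian n (St (k + 1)) (fun m => (ξ m : E)) =
        -(∑ n, ⟪siteGrad n S (fun m => (ξ m : E)), siteGrad n (St k) (fun m => (ξ m : E))⟫) +
          c (k + 1)) {a : ℝ}
    (hodd : ∀ j : ℕ, ∫ ω, (a - S (fun m => ((ω : Λ → sphere (0 : E) 1) m : E))) ^ (2 * j + 1)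
      ∂Measure.pi (fun _ : Λ => uniformSphere (volume : Measure E)) = 0) :
    c 0 = -a := by
  have h := luscher_constant_even_eq_zero_of_odd_moments hS hSt h0 hs hodd 0
  rw [mul_zero, update_self] at h
  linarith

end Parity

/-! ## §3 The sublattice flip of the Engel–Schaefer action on a bipartite coupling graph -/

section Flip

omit [Fintype Λ] [DecidableEq Λ] [Nontrivial E] in
/-- **The antipodal map preserves the normalised sphere measure** (`σ̄` is covariant under linear
isometries; `−id` is one, and Lebesgue measure is invariant under it). -/
theorem measurePreserving_neg_uniformSphere :
    MeasurePreserving (fun v : sphere (0 : E) 1 => -v) (uniformSphere (volume : Measure E))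
      (uniformSphere (volume : Measure E)) := by
  have hfun : (fun v : sphere (0 : E) 1 => -v) = ⇑(isoSphere (LinearIsometryEquiv.neg ℝ (E := E))) := by
    funext v
    ext
    simp [coe_neg_sphere, LinearIsometryEquiv.coe_neg]
  refine ⟨by rw [hfun]; exact (isoSphere _).measurable, ?_⟩
  rw [hfun, uniformSphere, Measure.map_smul, map_isoSphere_toSphere,
    (LinearIsometryEquiv.neg ℝ (E := E)).measurePreserving.map_eq]

variable (A : Set Λ) [DecidablePred (· ∈ A)]

omit [DecidableEq Λ] in
/-- **The sublattice flip `ω_n ↦ −ω_n (n ∈ A)` preserves `π̄`.** -/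
theorem measurePreserving_sublatticeFlip :
    MeasurePreserving (fun (ω : Λ → sphere (0 : E) 1) (n : Λ) => if n ∈ A then -ω n else ω n)
      (Measure.pi (fun _ : Λ => uniformSphere (volume : Measure E)))
      (Measure.pi (fun _ : Λ => uniformSphere (volume : Measure E))) := by
  have h := measurePreserving_pi (fun _ : Λ => uniformSphere (volume : Measure E))
    (fun _ : Λ => uniformSphere (volume : Measure E))
    (f := fun n (v : sphere (0 : E) 1) => if n ∈ A then -v else v) fun n => by
      by_cases hn : n ∈ A
      · simp only [hn, if_true]; exact measurePreserving_neg_uniformSphere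
      · simp only [hn, if_false]; exact MeasurePreserving.id _
  exact h

omit [InnerProductSpace ℝ E] [FiniteDimensional ℝ E] [MeasurableSpace E] [BorelSpace E] [Fintype Λ]
  [DecidableEq Λ] [Nontrivial E] in
/-- The flip is an involution. -/
theorem sublatticeFlip_involutive :
    Involutive (fun (ω : Λ → sphere (0 : E) 1) (n : Λ) => if n ∈ A then -ω n else ω n) := by
  intro ω
  funext n
  by_cases hn : n ∈ A <;> simp [hn]

variable {A} {U : Λ → Λ → (E →L[ℝ] E)}

omit [FiniteDimensional ℝ E] [MeasurableSpace E] [BorelSpace E] [DecidableEq Λ] [Nontrivial E] in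
/-- **On a bipartite coupling graph the sublattice flip reverses `S − S₀`**: if `U_nm ≠ 0` only
between `A` and its complement, then `S(flip x) − S₀ = −(S(x) − S₀)` for the E–S action. -/
theorem esAction_sublatticeFlip (hbip : ∀ n m, U n m ≠ 0 → (n ∈ A ↔ m ∉ A)) (κ S₀ : ℝ)
    (x : Λ → E) :
    esAction κ S₀ U (fun n => if n ∈ A then -x n else x n) - S₀ = -(esAction κ S₀ U x - S₀) := by
  rw [esAction_sub_const, esAction_sub_const]
  simp only [localField, inner_sum, Finset.mul_sum, ← Finset.sum_neg_distrib]
  refine Finset.sum_congr rfl fun n _ => Finset.sum_congr rfl fun m _ => ?_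
  by_cases hU : U n m = 0
  · simp [hU]
  · have hnm := hbip n m hU
    by_cases hn : n ∈ A
    · have hm : m ∉ A := hnm.1 hn
      simp only [hn, hm, if_true, if_false, inner_neg_left]
      ring
    · have hm : m ∈ A := by
        by_contra hm; exact hn (hnm.2 hm)
      simp only [hn, hm, if_true, if_false, map_neg, inner_neg_right]
      ring

omit [DecidableEq Λ] in
/-- **Every odd central moment of the E–S action vanishes on a bipartite coupling graph**:
`∫(S₀ − S)^{2j+1}dπ̄ = 0` (the flip preserves `π̄` and reverses the sign of the integrand). -/
theorem integral_odd_pow_esAction_sub_eq_zero (hbip : ∀ n m, U n m ≠ 0 → (n ∈ A ↔ m ∉ A))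
    (κ S₀ : ℝ) (j : ℕ) :
    ∫ ω, (S₀ - esAction κ S₀ U (fun m => ((ω : Λ → sphere (0 : E) 1) m : E))) ^ (2 * j + 1)
      ∂Measure.pi (fun _ : Λ => uniformSphere (volume : Measure E)) = 0 := by
  set g : (Λ → sphere (0 : E) 1) → ℝ :=
    fun ω => (S₀ - esAction κ S₀ U (fun m => (ω m : E))) ^ (2 * j + 1) with hg
  have hΦ := measurePreserving_sublatticeFlip (E := E) A
  have hinv := sublatticeFlip_involutive (E := E) A
  have hemb : MeasurableEmbedding
      (fun (ω : Λ → sphere (0 : E) 1) (n : Λ) => if n ∈ A then -ω n else ω n) :=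
    (MeasurableEquiv.ofInvolutive _ hinv hΦ.measurable).measurableEmbedding
  have hcomp := hΦ.integral_comp hemb g
  have hflip : ∀ ω : Λ → sphere (0 : E) 1,
      g (fun n => if n ∈ A then -ω n else ω n) = -g ω := fun ω => by
    simp only [hg]
    have hcoe : (fun m => (((fun n => if n ∈ A then -ω n else ω n) m : sphere (0 : E) 1) : E)) =
        fun m => if m ∈ A then -(ω m : E) else (ω m : E) := by
      funext m
      by_cases hm : m ∈ A <;> simp [hm, coe_neg_sphere]
    rw [hcoe]
    have hS := esAction_sublatticeFlip (A := A) hbip κ S₀ (fun m => (ω m : E))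
    have hodd : Odd (2 * j + 1) := ⟨j, rfl⟩
    rw [← hodd.neg_pow]
    congr 1
    linarith
  simp_rw [hflip, integral_neg] at hcomp
  change ∫ ω, g ω ∂Measure.pi (fun _ : Λ => uniformSphere (volume : Measure E)) = 0
  linarith

variable {St : ℕ → (Λ → E) → ℝ} {c : ℕ → ℝ}

/-- **ON A BIPARTITE COUPLING GRAPH EVERY EVEN CONSTANT OF LÜSCHER'S RECURSION FOR THE CP(N−1)/O(N)
ACTION VANISHES**: `ċ_{2j} = 0` for `j ≥ 1` and every `C²` Lüscher series of `S = esAction κ S₀ U`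
(`U_nm ≠ 0` only between `A` and `Λ∖A`) — `Ċ_t + S₀` is an odd function of the flow time. -/
theorem luscher_constant_even_eq_zero_esAction_bipartite
    (hbip : ∀ n m, U n m ≠ 0 → (n ∈ A ↔ m ∉ A)) (κ S₀ : ℝ) (hSt : ∀ k, ContDiff ℝ 2 (St k))
    (h0 : ∀ ξ : Λ → sphere (0 : E) 1,
      -∑ n, siteLaplacian n (St 0) (fun m => (ξ m : E)) = esAction κ S₀ U (fun m => (ξ m : E)) + c 0)
    (hs : ∀ k, ∀ ξ : Λ → sphere (0 : E) 1,
      -∑ n, siteLaplacian n (St (k + 1)) (fun m => (ξ m : E)) =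
        -(∑ n, ⟪siteGrad n (esAction κ S₀ U) (fun m => (ξ m : E)),
            siteGrad n (St k) (fun m => (ξ m : E))⟫) + c (k + 1))
    {j : ℕ} (hj : 1 ≤ j) : c (2 * j) = 0 :=
  luscher_constant_two_mul_eq_zero (contDiff_esAction U κ S₀) hSt h0 hs
    (integral_odd_pow_esAction_sub_eq_zero hbip κ S₀) hj

/-- In particular **the NNLO constant vanishes**: `ċ₂ = 0` on a bipartite coupling graph. -/
theorem luscher_constant_two_eq_zero_esAction_bipartite
    (hbip : ∀ n m, U n m ≠ 0 → (n ∈ A ↔ m ∉ A)) (κ S₀ : ℝ) (hSt : ∀ k, ContDiff ℝ 2 (St k))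
    (h0 : ∀ ξ : Λ → sphere (0 : E) 1,
      -∑ n, siteLaplacian n (St 0) (fun m => (ξ m : E)) = esAction κ S₀ U (fun m => (ξ m : E)) + c 0)
    (hs : ∀ k, ∀ ξ : Λ → sphere (0 : E) 1,
      -∑ n, siteLaplacian n (St (k + 1)) (fun m => (ξ m : E)) =
        -(∑ n, ⟪siteGrad n (esAction κ S₀ U) (fun m => (ξ m : E)),
            siteGrad n (St k) (fun m => (ξ m : E))⟫) + c (k + 1)) :
    c 2 = 0 :=
  luscher_constant_even_eq_zero_esAction_bipartite hbip κ S₀ hSt h0 hs (j := 1) le_rfl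

end Flip

end Summit.Ventures.LatticeQCDFlow.Exactness

end
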